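import Summits.QuantumFields.BalabanUV.Beta.D1BFx.RestKernelWords
import Summits.QuantumFields.BalabanUV.Beta.D1BFx.GhostWordFamilies
import Summits.QuantumFields.BalabanUV.Beta.D1BFx.RestLegSandwich

/-!
# `BalabanUV.Beta.D1BFx.RestKernelSandwichUnit` — road «BF-x» for binder row D1, slot (K), DICT-CHAIN-SPEC §2 (II) row RK-SAND: **«RK-SAND GENERIC-IN-JETS» —
# THE 1 + 3 SANDWICH CROSS WORDS `RestKernelWords.crossWord (½•Ga) ((−½)•sandP_ff) V W u` ARE (5.10)-KERNELS IN THE MASS CURRENCY, GENERIC IN THE ff-JETS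
# `V`, `W` WITH THE JETS' MASSES DISPLAYED**, the two legs read modulo [B5, Prop. 1.2] ∧ [B5, (1.126)–(1.127)] BY NAME (`GluonLegProfile.exists_abs_Ga_le_profile`,
# `RestLegSandwich.exists_decays_blk_sandP_road`) — OWNER WORD W-7 (2) ∕ OFFER O-d1leaf01-g21-2 «GO, STATEMENT-FIRST, THIS SHAPE»

STATUS: [folklore] assembly BY NAME of leaf-04 g18's FILE 1b mass currency (`GhostWordFamilies.decay510_tadpoleWord_of_mass` ∕
`decay510_biBubbleWord_of_decays_bdd_mass`) with leaf-01's two leg letters; 0 `sorry`; 0 new definitions; 0 notation; 0 cited facts beyond the two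
named hypotheses `h12 ∕ h126` the leg files already carry.  HONEST: 0 root-level binders discharged (hW ∕ hR-sockets ∕ hSX-socket ∕ D1Tel ∕ D1Rep — 0);
(K) NOT closed (the N-side dictionary (A2-N) must still supply the jets' masses `mV`, `mW` with their n-powers, and the slot needs ALL of `υ` + `hptw`);
NOT D1, NOT `BetaPertH`, NOT continuum, NOT Clay.

ABSOLUTE RULE (cell charter, verbatim): «No internally-minted statement may enter as a cited fact. Every hypothesis is either kernel-proved in
this package or a verbatim quotation of a PUBLISHED theorem with page reference. The manuscript(s) under audit are NOT citable for their own
disputed steps — they are the thing under adjudication; programme-internal (2001/route/tribunal) claims are never citable.»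

WHY (`HOME/b2b-balaban-beta-d1-p2/DICT-CHAIN-SPEC.md` §2 (II) row RK-SAND = leaf-01's since g16; OWNER WORD W-7 (2), journal l.39640: «the four sandwich cross
words `RestKernelWords.crossWord (½•Ga) ((−½)•sandP_ff) V W u` as `Decay510` kernels in leaf-04's MASS currency, GENERIC in the ff-jets `V W` with the jets'
masses DISPLAYED (the (A2-N) dictionary supplies them later — do NOT guess the N-side table letters); legs by `GluonLegProfile.exists_abs_Ga_le_profile` mod
`h12`∕`h126` + `RestLegSandwich.exists_decays_blk_sandP_road`»).  `n = m + 1` throughout §3.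

CONTENT.
* §1 [folklore, any `D`, any fibre `F`, any legs `A B`] the word rows: **`decay510_crossWord_inl`** (the tadpole word `½·tadpole B (W μ 0 ν z)`:
  `Bdd B SB` and the table's mass letter `Σ'|W μ 0 ν z| ≤ mW·e^{−κ|z|₁}` ⊢ constant `½·(SB·mW)`, rate `κ`); **`decay510_crossWord_inr`** (the three bubble
  words `−½·biBubble L_x (V μ 0) L_y (V ν z)`, `L_true = B`, `L_false = A`, and the empty word `(x, y) = (false, false)`: both legs `Decays · S· σ` at one rate
  `σ ≥ 0`, the vertex family's centred weighted masses `≤ mV` (centre `N•y`, rate `σ`, every direction) ⊢ constant `½·(S_x·S_y·mV·mV)`, rate `σ·N`);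
  the (1.22) read-outs **`absMoment₂_crossWord_inl ∕ _inr`**, **`abs_secondMoment_crossWord_inl ∕ _inr`** (`|M₂| ≤ constant × Σ'_x |x|₁² e^{−rate|x|₁}`).
* §2 [mod `h12 ∧ h126`, `D = 4`] **`exists_road_legs`**: ONE n-free triple `kG, K ≥ 0`, `c > 0` with, for every `m`,
  `Decays (½•Ga n a) (kG∕2) (c∕n)` and `Decays ((−½)•(sandP …)_ff) (K∕2∕n²) (c∕n)` (`c = min (δ_G∕4) c_sand`; `|v|₁ ≤ 4‖v‖∞`, `nrm ≥ 1`).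
* §3 [mod `h12 ∧ h126`] **`exists_decay510_crossWord_road`**: for every `m`, every ff-jet pair `(V, W)` whose masses are displayed at a rate `σ ≤ c∕n`, the
  four road words are `Decay510` with constants `½·(K∕(2n²))·mW` (tadpole, rate `κ`) and `½·(L_x·L_y·mV²)`, `L_true = K∕(2n²)`, `L_false = kG∕2` (bubbles,
  rate `σ·n`) — the sandwich leg's `n⁻²` DISPLAYED once per `B`-letter; the jets' own n-powers are the (A2-N) dictionary's to supply.
NOT HERE (honest): the jets' masses (row (A2-N)); the `Rk`-member wiring of these four words (after (A2-N), same pattern as `RestKernelGhostWiring`); RK-BLK.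
Unit `b2b-balaban-beta-d1-formalise-leaf-01` (gen 21), D1 formalisation swarm leaf prover 01, road «BF-x»; INTENT 3 «RK-SAND GENERIC-IN-JETS» (journal).
-/

noncomputable section

open Finset
open scoped BigOperators
open Literature.MathematicalPhysics.QuantumFieldTheory.Balaban1983to89
open Literature.MathematicalPhysics.QuantumFieldTheory.Balaban1983to89.Beta
open B12Sec2to5 (l1 l1_nonneg Decay510 secondMoment_abs_le_of_decay510)
open ExpKernelCalculus (Site MKer Decays tadpole l1_sub_symm)
open KernelWard (Bdd bdd_of_decays)
open DecimatedMomentSummable (AbsMoment₂ absMoment₂_of_decay510)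
open PoissonInterior (nrm one_le_nrm supNorm)
open VectorTailsLoc (fam kfam)
open Summit.QuantumFields.BalabanUV.Beta.TameKernelCalculus (decays_of_le)
open Summit.QuantumFields.BalabanUV.Beta.D1BFx.PackedKernelSplit (blk biBubble)
open Summit.QuantumFields.BalabanUV.Beta.D1BFx.CoarseGramInverse (multM)
open Summit.QuantumFields.BalabanUV.Beta.D1BFx.RWeightedLegPack (sandP)
open Summit.QuantumFields.BalabanUV.Beta.D1BFx.GluonLeg (Ga)
open Summit.QuantumFields.BalabanUV.Beta.D1BFx.GluonLegProfile (exists_abs_Ga_le_profile)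
open Summit.QuantumFields.BalabanUV.Beta.D1BFx.FrozenLegTails (nOf MOf hn1)
open Summit.QuantumFields.BalabanUV.Beta.D1BFx.RestLegSandwich (l1_le_four_mul_supNormP exists_decays_blk_sandP_road)
open Summit.QuantumFields.BalabanUV.Beta.D1BFx.RestKernelWords (crossWord)
open Summit.QuantumFields.BalabanUV.Beta.D1BFx.GhostWordFamilies (decay510_tadpoleWord_of_mass decay510_biBubbleWord_of_decays_bdd_mass)

namespace Summit.QuantumFields.BalabanUV.Beta.D1BFx.RestKernelSandwichUnit

/-! ## §1 The word rows, generic legs and jets -/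

section Words

variable {D : ℕ} {F : Type*} [Fintype F] {A B : MKer D F} {V : Fin D → Site D → MKer D F}
  {W : Fin D → Site D → Fin D → Site D → MKer D F} {SA SB σ mV mW κ : ℝ} {N : ℕ}

/-- [folklore] **THE SANDWICH TADPOLE WORD** `u = inl ()` (`½·tadpole B (W μ 0 ν z)`): `Bdd B SB` (`0 ≤ SB`) and the table's mass letter
`Σ'_{(y,x)} Σ_{g f} |W μ 0 ν z y x g f| ≤ mW·e^{−κ|z|₁}` (all `z`) ⊢ `Decay510 (crossWord A B V W (inl ()) μ ν) (½·(SB·mW)) κ`. -/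
theorem decay510_crossWord_inl (hB : Bdd B SB) (hSB : 0 ≤ SB) (μ ν : Fin D)
    (hWs : ∀ z, Summable fun p : Site D × Site D => ∑ g, ∑ f, |W μ 0 ν z p.1 p.2 g f|)
    (hWm : ∀ z, ∑' p : Site D × Site D, ∑ g, ∑ f, |W μ 0 ν z p.1 p.2 g f| ≤ mW * Real.exp (-κ * l1 z)) (u : Unit) :
    Decay510 (crossWord A B V W (Sum.inl u) μ ν) ((1 / 2) * (SB * mW)) κ := by
  have h := decay510_tadpoleWord_of_mass (𝒲 := W) hB hSB μ ν hWs hWm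
  intro z
  show |(1 / 2) * tadpole B (W μ 0 ν z)| ≤ _
  rw [abs_mul, abs_of_pos (by norm_num : (0 : ℝ) < 1 / 2), mul_assoc]
  exact mul_le_mul_of_nonneg_left (h z) (by norm_num)

/-- [folklore] **THE THREE SANDWICH BUBBLE WORDS AND THE EMPTY ONE** `u = inr (x, y)` (`−½·𝟙[x ∨ y]·biBubble L_x (V μ 0) L_y (V ν z)`, `L_true = B`,
`L_false = A`): both legs decaying at one rate `σ ≥ 0` (`Decays A SA σ`, `Decays B SB σ`, `0 ≤ SA, SB`) and the vertex family's centred weighted masses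
`Σ'_{(p,q)} Σ_{g f} |V ρ y p q g f|·e^{σ(|p − N•y|₁ + |q − N•y|₁)} ≤ mV` (every direction `ρ`, every bond `y`) ⊢
`Decay510 (crossWord A B V W (inr (x, y)) μ ν) (½·(S_x·S_y·mV·mV)) (σ·N)` with `S_true = SB`, `S_false = SA` (the empty word `(false, false)` trivially). -/
theorem decay510_crossWord_inr (hA : Decays A SA σ) (hB : Decays B SB σ) (hσ : 0 ≤ σ) (hSA : 0 ≤ SA) (hSB : 0 ≤ SB) (μ ν : Fin D)
    (hVs : ∀ ρ y, Summable fun p : Site D × Site D =>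
      ∑ g, ∑ f, |V ρ y p.1 p.2 g f| * Real.exp (σ * (l1 (p.1 - (N : ℤ) • y) + l1 (p.2 - (N : ℤ) • y))))
    (hVm : ∀ ρ y, ∑' p : Site D × Site D,
      ∑ g, ∑ f, |V ρ y p.1 p.2 g f| * Real.exp (σ * (l1 (p.1 - (N : ℤ) • y) + l1 (p.2 - (N : ℤ) • y))) ≤ mV)
    (x y : Bool) :
    Decay510 (crossWord A B V W (Sum.inr (x, y)) μ ν) ((1 / 2) * ((bif x then SB else SA) * (bif y then SB else SA) * mV * mV)) (σ * N) := by
  have hleg : ∀ b : Bool, Decays (bif b then B else A) (bif b then SB else SA) σ ∧ 0 ≤ (bif b then SB else SA) := fun b => by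
    cases b
    · exact ⟨hA, hSA⟩
    · exact ⟨hB, hSB⟩
  obtain ⟨hx, hSx⟩ := hleg x
  obtain ⟨hy, hSy⟩ := hleg y
  have hmV : 0 ≤ mV :=
    (tsum_nonneg fun p => Finset.sum_nonneg fun g _ => Finset.sum_nonneg fun f _ => by positivity).trans (hVm μ 0)
  have h := decay510_biBubbleWord_of_decays_bdd_mass (𝒱 := V) (𝒱' := V) hx (bdd_of_decays hy hσ) hσ hSx hSy μ ν (hVs μ) (hVm μ) (hVs ν) (hVm ν)
  intro z
  cases hb : (x || y)
  · simp only [crossWord, hb, cond_false, mul_zero, abs_zero]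
    exact mul_nonneg (mul_nonneg (by norm_num) (mul_nonneg (mul_nonneg (mul_nonneg hSx hSy) hmV) hmV)) (Real.exp_pos _).le
  · simp only [crossWord, hb, cond_true]
    rw [abs_mul, abs_neg, abs_of_pos (by norm_num : (0 : ℝ) < 1 / 2), mul_assoc]
    exact mul_le_mul_of_nonneg_left (h z) (by norm_num)

/-- [folklore] (1.22) read-out of the tadpole word: `0 < κ` ⊢ `AbsMoment₂` (the `hMR` row shape). -/
theorem absMoment₂_crossWord_inl (hB : Bdd B SB) (hSB : 0 ≤ SB) (μ ν : Fin D)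
    (hWs : ∀ z, Summable fun p : Site D × Site D => ∑ g, ∑ f, |W μ 0 ν z p.1 p.2 g f|)
    (hWm : ∀ z, ∑' p : Site D × Site D, ∑ g, ∑ f, |W μ 0 ν z p.1 p.2 g f| ≤ mW * Real.exp (-κ * l1 z)) (hκ : 0 < κ) (u : Unit) :
    AbsMoment₂ (crossWord A B V W (Sum.inl u) μ ν) :=
  absMoment₂_of_decay510 hκ (decay510_crossWord_inl hB hSB μ ν hWs hWm u)

/-- [folklore] (1.22) read-out of the tadpole word: `|M₂[crossWord … (inl ())]_{μν}| ≤ ½·(SB·mW) · Σ'_x |x|₁² e^{−κ|x|₁}`. -/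
theorem abs_secondMoment_crossWord_inl (hB : Bdd B SB) (hSB : 0 ≤ SB) (μ ν : Fin D)
    (hWs : ∀ z, Summable fun p : Site D × Site D => ∑ g, ∑ f, |W μ 0 ν z p.1 p.2 g f|)
    (hWm : ∀ z, ∑' p : Site D × Site D, ∑ g, ∑ f, |W μ 0 ν z p.1 p.2 g f| ≤ mW * Real.exp (-κ * l1 z)) (hκ : 0 < κ) (u : Unit) :
    |B12Beta.secondMoment (crossWord A B V W (Sum.inl u)) μ ν| ≤ (1 / 2) * (SB * mW) * ∑' x : Site D, l1 x ^ 2 * Real.exp (-κ * l1 x) :=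
  (secondMoment_abs_le_of_decay510 hκ (decay510_crossWord_inl hB hSB μ ν hWs hWm u)).2

/-- [folklore] (1.22) read-out of the bubble words: `0 < σ`, `1 ≤ N` ⊢ `AbsMoment₂` (the `hMR` row shape). -/
theorem absMoment₂_crossWord_inr (hA : Decays A SA σ) (hB : Decays B SB σ) (hσ : 0 < σ) (hSA : 0 ≤ SA) (hSB : 0 ≤ SB) (hN : 1 ≤ N) (μ ν : Fin D)
    (hVs : ∀ ρ y, Summable fun p : Site D × Site D =>
      ∑ g, ∑ f, |V ρ y p.1 p.2 g f| * Real.exp (σ * (l1 (p.1 - (N : ℤ) • y) + l1 (p.2 - (N : ℤ) • y))))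
    (hVm : ∀ ρ y, ∑' p : Site D × Site D,
      ∑ g, ∑ f, |V ρ y p.1 p.2 g f| * Real.exp (σ * (l1 (p.1 - (N : ℤ) • y) + l1 (p.2 - (N : ℤ) • y))) ≤ mV)
    (x y : Bool) : AbsMoment₂ (crossWord A B V W (Sum.inr (x, y)) μ ν) :=
  absMoment₂_of_decay510 (mul_pos hσ (by exact_mod_cast hN)) (decay510_crossWord_inr hA hB hσ.le hSA hSB μ ν hVs hVm x y)

/-- [folklore] (1.22) read-out of the bubble words: `|M₂[crossWord … (inr (x, y))]_{μν}| ≤ ½·(S_x·S_y·mV·mV) · Σ'_z |z|₁² e^{−σN|z|₁}`. -/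
theorem abs_secondMoment_crossWord_inr (hA : Decays A SA σ) (hB : Decays B SB σ) (hσ : 0 < σ) (hSA : 0 ≤ SA) (hSB : 0 ≤ SB) (hN : 1 ≤ N)
    (μ ν : Fin D)
    (hVs : ∀ ρ y, Summable fun p : Site D × Site D =>
      ∑ g, ∑ f, |V ρ y p.1 p.2 g f| * Real.exp (σ * (l1 (p.1 - (N : ℤ) • y) + l1 (p.2 - (N : ℤ) • y))))
    (hVm : ∀ ρ y, ∑' p : Site D × Site D,
      ∑ g, ∑ f, |V ρ y p.1 p.2 g f| * Real.exp (σ * (l1 (p.1 - (N : ℤ) • y) + l1 (p.2 - (N : ℤ) • y))) ≤ mV)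
    (x y : Bool) :
    |B12Beta.secondMoment (crossWord A B V W (Sum.inr (x, y))) μ ν|
      ≤ (1 / 2) * ((bif x then SB else SA) * (bif y then SB else SA) * mV * mV) * ∑' z : Site D, l1 z ^ 2 * Real.exp (-(σ * N) * l1 z) :=
  (secondMoment_abs_le_of_decay510 (mul_pos hσ (by exact_mod_cast hN)) (decay510_crossWord_inr hA hB hσ.le hSA hSB μ ν hVs hVm x y)).2

end Words

/-! ## §2 The road's two leg letters at one n-free scale-`n` rate (mod `h12 ∧ h126`) -/

section Road

variable {a : ℝ} (ha : 0 < a)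
include ha

/-- [folklore] **THE TWO LEGS OF THE SANDWICH SPLIT DECAY AT ONE COMMON RATE `c∕n`, n-FREE LETTERS** (mod [B5, Prop. 1.2] ∧ [B5, (1.126)–(1.127)] BY NAME):
one triple `kG, K ≥ 0`, `c > 0`, chosen before `n`, with `Decays (½•Ga n a) (kG∕2) (c∕n)` (the fine leg's damped Coulomb profile
`GluonLegProfile.exists_abs_Ga_le_profile`: `nrm ≥ 1`, `|v|₁ ≤ 4‖v‖∞`) and `Decays ((−½)•(sandP n (Ga n a) (multM n (2a∕n⁸) 2))_ff) (K∕2∕n²) (c∕n)`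
(`RestLegSandwich.exists_decays_blk_sandP_road`) for every `m` (`n = m + 1`; `c = min (δ_G∕4) c_sand`). -/
theorem exists_road_legs (h12 : B5.Prop12Printed (fam nOf hn1 MOf a ha)) (h126 : B5.Kernel126_127Printed (kfam nOf MOf)) :
    ∃ kG K c : ℝ, 0 < c ∧ 0 ≤ kG ∧ 0 ≤ K ∧ ∀ m : ℕ,
      Decays ((2 : ℝ)⁻¹ • Ga (m + 1) a) (kG / 2) (c / ((m + 1 : ℕ) : ℝ)) ∧
      Decays ((-(2 : ℝ)⁻¹) • blk (sandP (m + 1) (Ga (m + 1) a) (multM (m + 1) (2 * a / ((m + 1 : ℕ) : ℝ) ^ 8) 2)) true true)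
        (K / 2 / (((m + 1 : ℕ) : ℝ)) ^ 2) (c / ((m + 1 : ℕ) : ℝ)) := by
  obtain ⟨kG, δ, hδ, hkG, hG⟩ := exists_abs_Ga_le_profile a ha h12 h126
  obtain ⟨K, c, hc, hK, hS⟩ := exists_decays_blk_sandP_road ha h12 h126
  refine ⟨kG, K, min (δ / 4) c, lt_min (by positivity) hc, hkG, hK, fun m => ⟨?_, ?_⟩⟩
  · intro x y κ l
    have hn : (0 : ℝ) < ((m + 1 : ℕ) : ℝ) := by exact_mod_cast Nat.succ_pos m
    haveI : NeZero (m + 1) := ⟨Nat.succ_ne_zero m⟩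
    have h1 := hG (m + 1) x y κ l
    rw [show ((2 : ℝ)⁻¹ • Ga (m + 1) a) x y κ l = (2 : ℝ)⁻¹ * Ga (m + 1) a x y κ l from rfl, abs_mul,
      abs_of_pos (by norm_num : (0 : ℝ) < 2⁻¹)]
    have hE : Real.exp (-(δ / ((m + 1 : ℕ) : ℝ)) * (supNorm (d := 4) (y - x) : ℝ))
        ≤ Real.exp (-(min (δ / 4) c / ((m + 1 : ℕ) : ℝ)) * l1 (x - y)) := by
      rw [Real.exp_le_exp, l1_sub_symm x y]
      have hl := l1_le_four_mul_supNormP (y - x)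
      have hmin : min (δ / 4) c ≤ δ / 4 := min_le_left _ _
      have hl0 := l1_nonneg (y - x)
      have h3 : min (δ / 4) c / ((m + 1 : ℕ) : ℝ) * l1 (y - x) ≤ (δ / 4) / ((m + 1 : ℕ) : ℝ) * (4 * (supNorm (d := 4) (y - x) : ℝ)) :=
        mul_le_mul (div_le_div_of_nonneg_right hmin hn.le) hl hl0 (by positivity)
      have h4 : (δ / 4) / ((m + 1 : ℕ) : ℝ) * (4 * (supNorm (d := 4) (y - x) : ℝ)) = δ / ((m + 1 : ℕ) : ℝ) * (supNorm (d := 4) (y - x) : ℝ) := by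
        field_simp
      linarith
    have h2 : kG * Real.exp (-(δ / ((m + 1 : ℕ) : ℝ)) * (supNorm (d := 4) (y - x) : ℝ)) / nrm (d := 4) (y - x) ^ 2
        ≤ kG * Real.exp (-(min (δ / 4) c / ((m + 1 : ℕ) : ℝ)) * l1 (x - y)) := by
      have hnrm : 1 ≤ nrm (d := 4) (y - x) ^ 2 := one_le_pow₀ (one_le_nrm _)
      exact (div_le_self (by positivity) hnrm).trans (mul_le_mul_of_nonneg_left hE hkG)
    calc (2 : ℝ)⁻¹ * |Ga (m + 1) a x y κ l| ≤ (2 : ℝ)⁻¹ * (kG * Real.exp (-(min (δ / 4) c / ((m + 1 : ℕ) : ℝ)) * l1 (x - y))) :=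
          mul_le_mul_of_nonneg_left (h1.trans h2) (by norm_num)
      _ = kG / 2 * Real.exp (-(min (δ / 4) c / ((m + 1 : ℕ) : ℝ)) * l1 (x - y)) := by ring
  · intro x y κ l
    have hn : (0 : ℝ) < ((m + 1 : ℕ) : ℝ) := by exact_mod_cast Nat.succ_pos m
    have h1 := decays_of_le (hS m) (div_le_div_of_nonneg_right (min_le_right (δ / 4) c) hn.le) x y κ l
    rw [abs_of_nonneg (by positivity : (0 : ℝ) ≤ K / (((m + 1 : ℕ) : ℝ)) ^ 2)] at h1
    rw [show ((-(2 : ℝ)⁻¹) • blk (sandP (m + 1) (Ga (m + 1) a) (multM (m + 1) (2 * a / ((m + 1 : ℕ) : ℝ) ^ 8) 2)) true true) x y κ l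
        = (-(2 : ℝ)⁻¹) * blk (sandP (m + 1) (Ga (m + 1) a) (multM (m + 1) (2 * a / ((m + 1 : ℕ) : ℝ) ^ 8) 2)) true true x y κ l from rfl,
      abs_mul, abs_neg, abs_of_pos (by norm_num : (0 : ℝ) < 2⁻¹)]
    refine (mul_le_mul_of_nonneg_left h1 (by norm_num)).trans (le_of_eq ?_)
    ring

/-! ## §3 The road's four sandwich words, generic ff-jets with displayed masses (mod `h12 ∧ h126`) -/

/-- [folklore] **«RK-SAND GENERIC-IN-JETS»**: modulo [B5, Prop. 1.2] ∧ [B5, (1.126)–(1.127)] BY NAME there is ONE n-free triple `kG, K ≥ 0`, `c > 0` such that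
for every `m` (`n = m + 1`), every ff-jet pair `V`, `W` (fine fibre `Fin 4`, coarse bonds of blocking `n`), every rate `0 ≤ σ ≤ c∕n` at which the vertex
family's centred weighted masses are `≤ mV` and every table mass letter `mW·e^{−κ|z|₁}`, the four cross words of the split leg `½•Ga + (−½)•sandP_ff`
(`NlegKHessSplit.hessKer_NlegRoad_split`, `RestKernelWords` §3–§4) satisfy
`Decay510 (crossWord … (inl ()) μ ν) (½·((K∕2∕n²)·mW)) κ` and `Decay510 (crossWord … (inr (x, y)) μ ν) (½·(L_x·L_y·mV·mV)) (σ·n)`, `L_true = K∕2∕n²`,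
`L_false = kG∕2` — the sandwich leg's `n⁻²` once per `B`-letter; the jets' n-powers are (A2-N)'s.  The (1.22) rows follow by §1
(`abs_secondMoment_crossWord_inl ∕ _inr`, `absMoment₂_crossWord_inl ∕ _inr`). -/
theorem exists_decay510_crossWord_road (h12 : B5.Prop12Printed (fam nOf hn1 MOf a ha)) (h126 : B5.Kernel126_127Printed (kfam nOf MOf)) :
    ∃ kG K c : ℝ, 0 < c ∧ 0 ≤ kG ∧ 0 ≤ K ∧ ∀ (m : ℕ) (V : Fin 4 → Site 4 → MKer 4 (Fin 4)) (W : Fin 4 → Site 4 → Fin 4 → Site 4 → MKer 4 (Fin 4))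
      (σ mV mW κ : ℝ) (μ ν : Fin 4), 0 ≤ σ → σ ≤ c / ((m + 1 : ℕ) : ℝ) →
      (∀ ρ y, Summable fun p : Site 4 × Site 4 =>
        ∑ g, ∑ f, |V ρ y p.1 p.2 g f| * Real.exp (σ * (l1 (p.1 - ((m + 1 : ℕ) : ℤ) • y) + l1 (p.2 - ((m + 1 : ℕ) : ℤ) • y)))) →
      (∀ ρ y, ∑' p : Site 4 × Site 4,
        ∑ g, ∑ f, |V ρ y p.1 p.2 g f| * Real.exp (σ * (l1 (p.1 - ((m + 1 : ℕ) : ℤ) • y) + l1 (p.2 - ((m + 1 : ℕ) : ℤ) • y))) ≤ mV) →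
      (∀ z, Summable fun p : Site 4 × Site 4 => ∑ g, ∑ f, |W μ 0 ν z p.1 p.2 g f|) →
      (∀ z, ∑' p : Site 4 × Site 4, ∑ g, ∑ f, |W μ 0 ν z p.1 p.2 g f| ≤ mW * Real.exp (-κ * l1 z)) →
      (∀ u : Unit, Decay510 (crossWord ((2 : ℝ)⁻¹ • Ga (m + 1) a)
          ((-(2 : ℝ)⁻¹) • blk (sandP (m + 1) (Ga (m + 1) a) (multM (m + 1) (2 * a / ((m + 1 : ℕ) : ℝ) ^ 8) 2)) true true) V W (Sum.inl u) μ ν)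
          ((1 / 2) * (K / 2 / (((m + 1 : ℕ) : ℝ)) ^ 2 * mW)) κ) ∧
      (∀ x y : Bool, Decay510 (crossWord ((2 : ℝ)⁻¹ • Ga (m + 1) a)
          ((-(2 : ℝ)⁻¹) • blk (sandP (m + 1) (Ga (m + 1) a) (multM (m + 1) (2 * a / ((m + 1 : ℕ) : ℝ) ^ 8) 2)) true true) V W (Sum.inr (x, y)) μ ν)
          ((1 / 2) * ((bif x then K / 2 / (((m + 1 : ℕ) : ℝ)) ^ 2 else kG / 2) * (bif y then K / 2 / (((m + 1 : ℕ) : ℝ)) ^ 2 else kG / 2) * mV * mV))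
          (σ * ((m + 1 : ℕ) : ℝ))) := by
  obtain ⟨kG, K, c, hc, hkG, hK, hlegs⟩ := exists_road_legs ha h12 h126
  refine ⟨kG, K, c, hc, hkG, hK, fun m V W σ mV mW κ μ ν hσ0 hσc hVs hVm hWs hWm => ?_⟩
  obtain ⟨hA, hB⟩ := hlegs m
  have hn : (0 : ℝ) < ((m + 1 : ℕ) : ℝ) := by exact_mod_cast Nat.succ_pos m
  have hkG2 : (0 : ℝ) ≤ kG / 2 := by positivity
  have hK2 : (0 : ℝ) ≤ K / 2 / (((m + 1 : ℕ) : ℝ)) ^ 2 := by positivity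
  -- both legs at the jets' rate `σ ≤ c∕n`
  have hAσ : Decays ((2 : ℝ)⁻¹ • Ga (m + 1) a) (kG / 2) σ := by
    have h := decays_of_le hA hσc
    rwa [abs_of_nonneg hkG2] at h
  have hBσ : Decays ((-(2 : ℝ)⁻¹) • blk (sandP (m + 1) (Ga (m + 1) a) (multM (m + 1) (2 * a / ((m + 1 : ℕ) : ℝ) ^ 8) 2)) true true)
      (K / 2 / (((m + 1 : ℕ) : ℝ)) ^ 2) σ := by
    have h := decays_of_le hB hσc
    rwa [abs_of_nonneg hK2] at h
  refine ⟨fun u => ?_, fun x y => ?_⟩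
  · have h := decay510_crossWord_inl (A := (2 : ℝ)⁻¹ • Ga (m + 1) a) (V := V) (bdd_of_decays hBσ hσ0) hK2 μ ν hWs hWm u
    refine fun z => (h z).trans (le_of_eq ?_)
    ring
  · exact decay510_crossWord_inr (N := m + 1) hAσ hBσ hσ0 hkG2 hK2 μ ν hVs hVm x y

end Road

end Summit.QuantumFields.BalabanUV.Beta.D1BFx.RestKernelSandwichUnit

end
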